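import Literature.MathematicalPhysics.QuantumFieldTheory.Balaban1983to89.B1Eq324BenfattoSect5Cumulant
import Literature.Probability.LatticeModels.UrsellColourings
import HarnessLib

/-!
# `Balaban1983to89.B1Eq324BenfattoSect5JointCumulants` — [BenfattoEtAl1978] (2.7) p. 147 (joint truncated expectations) and
# §5 p. 157, displays (5.25)–(5.26) (+ the first term of (5.29), p. 158, in generic form): the «Leibnitz formula» for the
# truncated expectations of a SUM, the A-PRIORI BOUND on joint truncated expectations of bounded variables — the generic
# half of «(5.24) implies (5.26)» — and «the replacement of the χ's by 1», PROVED

statement-level skeleton of published theorems with citation tags; proofs where landed; nothing here is a claim about the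
Yang–Mills mass gap

WHY THIS MODULE (cell `pub-ymgap`, seat `dag-n08-b`, node N08 «first missing estimate» lane; sequel of
`B1Eq324BenfattoSect5Cumulant` = (5.16)–(5.22)).  After the per-box cumulant expansion (5.21)–(5.22), §5 of [BenfattoEtAl1978]
replaces the conditional truncated expectations `𝓔^T_{z_{Γ₁}}(Ψ_□χ; k)` by free ones.  Its first move, p. 157, splits
`Ψ_□ = Ψ₁ + Ψ₂ + Ψ₃` (5.23) with `Ψ₃ = H′^{(l)}` exponentially small (5.24), expands the `k`-th truncated expectation of the
sum multilinearly (5.25) and discards every term containing `Ψ₃` at the cost (5.26).  The STRUCTURAL inputs — what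
`Ψ₁, Ψ₂, Ψ₃` are and the bound (5.24) — belong to the boxes/corridors line (`B1Eq324BenfattoSect5Boxes`); what is proved
here is the generic measure theory and combinatorics print invokes in two sentences: *"we have used the elementary summation
properties of the truncated functions following from their definitions ("Leibnitz formula")"* and *"𝓔^T_{z_{Γ₁}} is a sum of
at most s₃ products of powers of Ψ₁χ, Ψ₂χ, Ψ₃χ and Ψ₃χ appears in at least one of the factors. Then (5.24) implies (5.26)"*.
The engines are the tree's Ursell calculus: the explicit Möbius formula `LatticeModels.ursellOf_eq_sum_setPartitions`, the
simultaneous multilinearity over colourings `LatticeModels.ursellOf_piFinset`, and the identification of a truncated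
expectation with a Ursell function `B1Eq323SetPartitions.ursellOf_nmoment_eq_truncExp`.

THE PRINTED TEXT (verbatim from the page images `bcg_p147.png`, `bcg_p157.png`).  p. 147: *"The first is the definition of
"cumulants" (or truncated expectations) of a family of random variables x₁ … x_s with respect to the probability measure
P:* `𝓔^T(x₁, …, x_s; k₁, …, k_s) = [∂^{k₁+…+k_s}/(∂θ₁^{k₁} … ∂θ_s^{k_s}) log ∫ exp Σ₁ˢ_i θ_i x_i dP]_{θ_i=0}`, `k_i = 0, 1, …`
(2.7) *which makes sense in an obvious way if ∫|x_i|^l P(dx) < ∞, l = 0, 1, …; i = 1, 2, … ."*  p. 157: *"The next step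
consists of trying to replace the conditional expectation 𝓔_{z_{Γ₁}} by the unconditioned one 𝓔₀. Consider
𝓔^T_{z_{Γ₁}}(Ψ_□χ_b^□; k) and decompose Ψ_□ as* `Ψ_□ = (H_{□′} + H_{□′,Γ₃(□)}) + (H_{Γ₁(□),Γ₂(□)} + H_{Γ₂(□)}) + H′^{(l)}`
(5.23) *where Γ₃(□) is a corridor adjacent to □′ with width ½b^{3/2} [hence Γ₃(□) ⊂ Γ₂(□)] (see Fig. 1) and H′^{(l)} can
be bounded by* `|H′^{(l)}χ_b^□| ≦ s₁Ab^{D+2d}e^{−(ϰ/8)b^{3/2}}` (5.24). *We denote the three addends in (5.23) Ψ₁, Ψ₂, Ψ₃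
respectively and χ_b^□ by χ then* `𝓔^T_{z_{Γ₁}}((Ψ₁ + Ψ₂ + Ψ₃)χ; k) = Σ_{k₁,k₂,k₃, (k₁+k₂+k₃)=k} k!/(k₁!k₂!k₃!)
𝓔^T_{z_{Γ₁}}(Ψ₁χ, Ψ₂χ, Ψ₃χ; k₁, k₂, k₃) = 𝓔^T_{z_{Γ₁}}(Ψ₁χ; k) + Σ_{k₂>0} 𝓔^T_{z_{Γ₁}}(Ψ₁χ, Ψ₂χ, k₁, k₂) k!/(k₁!k₂!)
+ Σ_{k₃>0} 𝓔^T_{z_{Γ₁}}(Ψ₁χ, Ψ₂χ, Ψ₃χ; k₁, k₂, k₃) k!/(k₁!k₂!k₃!)` (5.25) *and we have used the elementary summation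
properties of the truncated functions following from their definitions ("Leibnitz formula"). We bound the third term by
using that 𝓔^T_{z_{Γ₁}} is a sum of at most s₃ products of powers of Ψ₁χ, Ψ₂χ, Ψ₃χ and Ψ₃χ appears in at least one of the
factors. Then (5.24) implies:* `|Σ_{k₃>0} 𝓔^T_{z_{Γ₁}}(Ψ₁χ, Ψ₂χ, Ψ₃χ; k₁, k₂, k₃) k!/(k₁!k₂!k₃!)| ≦ s₃(s₁Ab^{D+2d})ᵏ
e^{−(ϰ/8)b^{3/2}}` (5.26).

DICTIONARY.  `P̄(dz_□|z_{Γ₁})` ↦ any probability measure `μ`.  `𝓔^T(X; k)` ↦ `B10Eq24Cumulant.truncExp X μ k`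
(= `B1Eq324BenfattoLemma.truncatedExp`, `B1Eq324BenfattoSect5Cumulant.truncatedExp_eq_truncExp`).  A JOINT truncated
expectation of `k` (possibly repeated) variables `Z₁, …, Z_k` ↦ the tree's Ursell function
`LatticeModels.ursellOf (P ↦ ∫ Π_{j∈P} Z_j dμ) univ` of the joint moments on the `k` SLOTS (`σ`, `|σ| = k`); print's
`𝓔^T(x₁,…,x_s;k₁,…,k_s)` is the case `Z = Y ∘ f` for a colouring `f : σ → ι` of the slots with multiplicities
`k_c = |f⁻¹(c)|` (slot-permutation invariant: `ursellOf_moment_comp_equiv`).  The sum `Σ_{k₁+k₂+k₃=k} k!/(k₁!k₂!k₃!) …` ↦ the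
sum over ALL colourings `f : σ → ι` (grouping by multiplicities gives the multinomial coefficients; the count is not
formalised); «the third term» (`k₃ > 0`) ↦ the colourings using the colour `c₀` of `Ψ₃`; the first two terms ↦
`𝓔^T((Ψ₁+Ψ₂)χ; k)`, i.e. (5.25) for the two remaining colours.

WHAT IS PROVED (theorems only; no definition, no named fact, no `sorry`; axioms standard).
* §1 **`abs_ursellOf_le`** — pure combinatorics: `m(∅) = 1`, `|m(P)| ≤ Π_{i∈P} K_i` on `P ⊆ V` ⟹
  `|mᵀ(V)| ≤ (Σ_{π ∈ 𝒫(V)} (|π| − 1)!)·Π_{i∈V} K_i` («a sum of at most s₃ products»: the explicit Möbius formula, each block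
  product `= Π_{i∈V} K_i` by `IsSetPartition.biUnion_id`).
* §2 `abs_integral_prod_le` (`|∫Π Z_i| ≤ Π K_i`), **`abs_ursellOf_moment_le`** (the a-priori bound for joint truncated
  expectations of a.e. bounded variables), ★ **`abs_ursellOf_moment_le_of_hits`** («Ψ₃χ appears in at least one of the
  factors»: a colouring using the ε-small colour has `|𝓔^T| ≤ (Σ_π(|π|−1)!)·ε·K^{k−1}`), `ursellOf_moment_comp_equiv`
  (symmetry under slot permutations).
* §3 ★ **`ursellOf_moment_sum_eq_sum`** — multilinearity of the joint truncated expectations of product moments in every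
  slot (slot-dependent finite sums `Σ_c W_{c,j}` ⟹ sum over colourings `f : σ → ι`); `truncExp_eq_ursellOf_moment`
  (`𝓔^T(S; |σ|)` IS the Ursell function of `P ↦ ∫Π_{j∈P} S`); ★ **`truncExp_sum_eq_sum_ursellOf`** = (5.25) in colouring
  form: `𝓔^T(Σ_c Y_c; k) = Σ_{f : σ → ι} 𝓔^T(Y_{f(1)}, …, Y_{f(k)})` for a.e. bounded `Y_c` under a probability measure.
* §4 ★ **`abs_truncExp_sum_sub_truncExp_sum_ne_le`** = (5.25) + (5.26) combined, stated with single-variable truncated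
  expectations only: `|𝓔^T(Σ_c Y_c; k) − 𝓔^T(Σ_{c≠c₀} Y_c; k)| ≤ |ι|^k·(Σ_π(|π|−1)!)·ε·K^{k−1}` when `|Y_c| ≤ K`,
  `|Y_{c₀}| ≤ ε ≤ K`; **`eq526_three`** — the same for print's three pieces: `|𝓔^T((Ψ₁+Ψ₂+Ψ₃)χ;k) − 𝓔^T((Ψ₁+Ψ₂)χ;k)| ≤
  3^k·(Σ_π(|π|−1)!)·ε·K^{k−1}`.
* §5 **`abs_ursellOf_moment_mul_sub_le`** — (5.29) FIRST TERM («the replacement of the χ's by 1») in GENERIC, WEAKER-THAN-PRINT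
  form: `|𝓔^T(Z₁χ,…,Z_kχ) − 𝓔^T(Z₁,…,Z_k)| ≤ 2^k·(Σ_π(|π|−1)!)·η·K^k` whenever `|Z_j| ≤ K`, `0 ≤ χ ≤ 1`, `P̄(χ ≠ 1) ≤ η^k`
  (multilinearity in `Z_jχ = Z_j − Z_j(1−χ)`; moments through a marked slot live on `{χ ≠ 1}`).

HONEST SCOPE / NOT HERE.  (i) Print DEFINES joint truncated expectations by the mixed derivatives (2.7); the tree's are
Möbius-defined Ursell functions of joint moments.  For ONE variable the two agree (`B1Eq323SetPartitions`,
`LatticeModels.CumulantsAnalytic`); for several variables the equivalence (Mastropietro (2.32)⟺(2.36), the source cited by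
`UrsellColourings`) is NOT re-proved here — which is why the consumer-facing §4 is stated with single-variable `truncExp`
only, where no such identification is needed.  (ii) The constant: print's `s₃` is unspecified («a sum of at most s₃
products»); here it is `|ι|^k·Σ_{π∈𝒫(k)}(|π|−1)!` (for three pieces `3^k·Σ_π(|π|−1)!`), and print's `(s₁Ab^{D+2d})^k
e^{−(ϰ/8)b^{3/2}}` is the instance `ε = s₁Ab^{D+2d}e^{−ϰb^{3/2}/8} ≤ K` up to relabelling the larger of `s₁, s₂` as the
common bound.  (ii′) §5 is AS PROVED WEAKER than AS PRINTED: print's first term of (5.29) carries `e^{−b²/4}`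
(from the Gaussian structure, App. D «point 2) and Lemma 1 of Appendix C»); the measure-theoretic §5 gives `η` with
`η^k = P̄(χ ≠ 1)`, i.e. the rate `e^{−b²/(4k)}` after (5.19) — enough for the FORM of (4.6)–(4.7) (dominated by
`e^{−ρ₃b^{3/2}}`), not print's constant.  (iii) NOT here: (5.23)/(5.24)/(5.27) (the pieces and the decay of `H′^{(l)}` — structural, boxes line);
(5.28)–(5.32) and Appendix D (the free-field/Wick replacement of `𝓔_{z_{Γ₁}}` by `𝓔₀`, «the properties of the conditioned
measure»); the multinomial COUNT in (5.25).  `BasicLemmaPrinted` stays OPEN.  NOT summit progress; count-neutral for N08;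
nothing of [Balaban1985UV3] is asserted.
-/

open MeasureTheory ProbabilityTheory Finset
open scoped BigOperators Nat

namespace Literature.MathematicalPhysics.QuantumFieldTheory.Balaban1983to89.B1Eq324BenfattoSect5JointCumulants

open _root_.MeasureTheory _root_.ProbabilityTheory
open Literature.Probability.LatticeModels
open Literature.MathematicalPhysics.QuantumFieldTheory.Balaban1983to89.B10Eq24Cumulant
open Literature.MathematicalPhysics.QuantumFieldTheory.Balaban1983to89.B1Eq323SetPartitions

/-! ## §1  The a-priori bound on a Ursell function (pure combinatorics) -/

section Combinatorial

variable {α : Type*} [DecidableEq α]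

/-- The product of a multiplicative weight over the blocks of a set partition is the product over the partitioned set.
[folklore] -/
private theorem prod_blocks_eq {V : Finset α} {π : Finset (Finset α)} (h : IsSetPartition V π) (K : α → ℝ) :
    ∏ P ∈ π, ∏ i ∈ P, K i = ∏ i ∈ V, K i := by
  rw [← h.biUnion_id, Finset.prod_biUnion h.pairwiseDisjoint]
  rfl

/-- **THE A-PRIORI BOUND ON A TRUNCATED FUNCTION** («𝓔^T_{z_{Γ₁}} is a sum of at most s₃ products of powers of Ψ₁χ, Ψ₂χ,
Ψ₃χ», p. 157): for a moment function `m` with `m(∅) = 1` and `|m(P)| ≤ Π_{i∈P} K_i` on the subsets of `V`, the Ursell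
(truncated) function obeys `|mᵀ(V)| ≤ (Σ_{π ∈ 𝒫(V)} (|π| − 1)!)·Π_{i∈V} K_i` — the explicit Möbius formula
`LatticeModels.ursellOf_eq_sum_setPartitions` term by term, each block product being `Π_{i∈V} K_i`.
[cite: BenfattoEtAl1978, (5.26) p.157] -/
theorem abs_ursellOf_le (m : Finset α → ℝ) (hm0 : m ∅ = 1) {V : Finset α} (hV : V.Nonempty) (K : α → ℝ)
    (hm : ∀ P, P ⊆ V → |m P| ≤ ∏ i ∈ P, K i) :
    |ursellOf m V| ≤ (∑ π ∈ setPartitions V, ((π.card - 1)! : ℝ)) * ∏ i ∈ V, K i := by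
  rw [ursellOf_eq_sum_setPartitions m hm0 hV, Finset.sum_mul]
  refine (Finset.abs_sum_le_sum_abs _ _).trans (Finset.sum_le_sum fun π hπ => ?_)
  have hπ' := mem_setPartitions.1 hπ
  rw [abs_mul, abs_mul, abs_pow, abs_neg, abs_one, one_pow, one_mul, Nat.abs_cast, ← prod_blocks_eq hπ' K,
    Finset.abs_prod]
  exact mul_le_mul_of_nonneg_left
    (Finset.prod_le_prod (fun P _ => abs_nonneg _) fun P hP => hm P (hπ'.subset hP)) (Nat.cast_nonneg _)

/-- The a-priori constant `Σ_{π ∈ 𝒫(V)} (|π| − 1)!` is non-negative. [folklore] -/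
private theorem apriori_nonneg (V : Finset α) : 0 ≤ ∑ π ∈ setPartitions V, ((π.card - 1)! : ℝ) :=
  Finset.sum_nonneg fun _ _ => Nat.cast_nonneg _

end Combinatorial

/-! ## §2  Joint moments and joint truncated expectations of bounded variables -/

section Moments

variable {Ω : Type*} {mΩ : MeasurableSpace Ω} {μ : Measure Ω} [IsProbabilityMeasure μ]
variable {α : Type*}

/-- A joint moment of a.e. bounded variables under a probability measure: `|∫ Π_{i∈P} Z_i dP̄| ≤ Π_{i∈P} K_i`.
[cite: BenfattoEtAl1978, (2.7) p.147] -/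
theorem abs_integral_prod_le {Z : α → Ω → ℝ} {K : α → ℝ} (P : Finset α)
    (hZK : ∀ i ∈ P, ∀ᵐ ω ∂μ, |Z i ω| ≤ K i) :
    |∫ ω, ∏ i ∈ P, Z i ω ∂μ| ≤ ∏ i ∈ P, K i := by
  have hae : ∀ᵐ ω ∂μ, ∀ i ∈ P, |Z i ω| ≤ K i := (Filter.eventually_all_finset P).2 hZK
  calc |∫ ω, ∏ i ∈ P, Z i ω ∂μ| ≤ ∫ ω, |∏ i ∈ P, Z i ω| ∂μ := abs_integral_le_integral_abs
    _ ≤ ∫ _ω, ∏ i ∈ P, K i ∂μ := by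
        refine integral_mono_of_nonneg (ae_of_all _ fun ω => abs_nonneg _) (integrable_const _)
          (hae.mono fun ω hω => ?_)
        dsimp only
        rw [Finset.abs_prod]
        exact Finset.prod_le_prod (fun i _ => abs_nonneg _) hω
    _ = ∏ i ∈ P, K i := by simp

/-- A finite product of a.e. bounded, a.e. strongly measurable variables is integrable on a probability space.
[folklore] -/
private theorem integrable_prod_of_bound {Z : α → Ω → ℝ} {K : α → ℝ} (P : Finset α)
    (hZm : ∀ i ∈ P, AEStronglyMeasurable (Z i) μ) (hZK : ∀ i ∈ P, ∀ᵐ ω ∂μ, |Z i ω| ≤ K i) :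
    Integrable (fun ω => ∏ i ∈ P, Z i ω) μ := by
  have hae : ∀ᵐ ω ∂μ, ∀ i ∈ P, |Z i ω| ≤ K i := (Filter.eventually_all_finset P).2 hZK
  have hm : AEStronglyMeasurable (fun ω => ∏ i ∈ P, Z i ω) μ := by
    have h := Finset.aestronglyMeasurable_prod P hZm
    have hfun : (∏ i ∈ P, Z i) = fun ω => ∏ i ∈ P, Z i ω := by
      funext ω
      simp [Finset.prod_apply]
    rwa [hfun] at h
  refine Integrable.mono' (integrable_const (∏ i ∈ P, K i)) hm (hae.mono fun ω hω => ?_)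
  rw [Real.norm_eq_abs, Finset.abs_prod]
  exact Finset.prod_le_prod (fun i _ => abs_nonneg _) hω

/-- **A-PRIORI BOUND ON A JOINT TRUNCATED EXPECTATION**: for variables `Z_i` with `|Z_i| ≤ K_i` a.e. under a
probability measure `P̄`, the truncated function of the joint moments `P ↦ ∫ Π_{i∈P} Z_i dP̄` on a nonempty `V`
obeys `|𝓔^T(Z_i, i ∈ V)| ≤ (Σ_{π ∈ 𝒫(V)} (|π| − 1)!)·Π_{i∈V} K_i` — a constant depending only on `|V|` times the
product of the bounds («s₃», p. 157). [cite: BenfattoEtAl1978, (5.26) p.157] -/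
theorem abs_ursellOf_moment_le [DecidableEq α] {Z : α → Ω → ℝ} {K : α → ℝ} {V : Finset α} (hV : V.Nonempty)
    (hZK : ∀ i ∈ V, ∀ᵐ ω ∂μ, |Z i ω| ≤ K i) :
    |ursellOf (fun P => ∫ ω, ∏ i ∈ P, Z i ω ∂μ) V| ≤
      (∑ π ∈ setPartitions V, ((π.card - 1)! : ℝ)) * ∏ i ∈ V, K i :=
  abs_ursellOf_le _ (by simp) hV K fun P hP => abs_integral_prod_le P fun i hi => hZK i (hP hi)

variable {σ ι : Type*} [Fintype σ] [DecidableEq σ] [DecidableEq ι]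

/-- **(5.26), generic half** — «Ψ₃χ appears in at least one of the factors. Then (5.24) implies (5.26)»: for a family
`Y_c` with `|Y_c| ≤ K` a.e. and ONE exponentially small member `|Y_{c₀}| ≤ ε ≤ K`, every colouring `f` of the `k = |σ|`
slots that USES the colour `c₀` has joint truncated expectation
`|𝓔^T(Y_{f(1)}, …, Y_{f(k)})| ≤ (Σ_{π ∈ 𝒫(k)} (|π| − 1)!)·ε·K^{k−1}`. [cite: BenfattoEtAl1978, (5.26) p.157] -/
theorem abs_ursellOf_moment_le_of_hits {Y : ι → Ω → ℝ} {K ε : ℝ} {c₀ : ι}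
    (hK : ∀ c, ∀ᵐ ω ∂μ, |Y c ω| ≤ K) (hε : ∀ᵐ ω ∂μ, |Y c₀ ω| ≤ ε) (hε0 : 0 ≤ ε) (hεK : ε ≤ K)
    (f : σ → ι) {j₀ : σ} (hj₀ : f j₀ = c₀) :
    |ursellOf (fun P : Finset σ => ∫ ω, ∏ j ∈ P, Y (f j) ω ∂μ) univ| ≤
      (∑ π ∈ setPartitions (univ : Finset σ), ((π.card - 1)! : ℝ)) * (ε * K ^ (Fintype.card σ - 1)) := by
  have hne : (univ : Finset σ).Nonempty := ⟨j₀, mem_univ _⟩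
  have hK0 : 0 ≤ K := hε0.trans hεK
  set Kf : σ → ℝ := fun j => if f j = c₀ then ε else K with hKf
  have h := abs_ursellOf_moment_le (μ := μ) (Z := fun j => Y (f j)) (K := Kf) hne (fun j _ => by
    by_cases hj : f j = c₀
    · simp only [hKf, hj, if_true]
      exact hε
    · simp only [hKf, hj, if_false]
      exact hK (f j))
  refine h.trans (mul_le_mul_of_nonneg_left ?_ (apriori_nonneg _))
  simp only [hKf]
  rw [Finset.prod_ite, Finset.prod_const, Finset.prod_const]
  set a := (univ.filter fun j => f j = c₀).card with ha_def
  set b := (univ.filter fun j => ¬f j = c₀).card with hb_def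
  have hab : a + b = Fintype.card σ := by
    rw [ha_def, hb_def, Finset.card_filter_add_card_filter_not]
    rfl
  have ha : 1 ≤ a := Finset.card_pos.2 ⟨j₀, by simp [hj₀]⟩
  have hsplit : ε ^ a = ε ^ (a - 1) * ε := by
    rw [← pow_succ, Nat.sub_add_cancel ha]
  rw [hsplit]
  calc ε ^ (a - 1) * ε * K ^ b ≤ K ^ (a - 1) * ε * K ^ b := by
        gcongr
    _ = ε * K ^ (a - 1 + b) := by rw [pow_add]; ring
    _ = ε * K ^ (Fintype.card σ - 1) := by rw [show a - 1 + b = Fintype.card σ - 1 by omega]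

omit [IsProbabilityMeasure μ] [DecidableEq ι] in
/-- **SYMMETRY**: the joint truncated expectation of a colouring is invariant under permuting the slots — it depends
only on the multiset `{f(1), …, f(k)}`, i.e. on the multiplicities `k₁, …, k_s` of (2.7)'s `𝓔^T(x₁,…,x_s;k₁,…,k_s)`
(so that grouping the colourings of (5.25) by type produces print's multinomial coefficients `k!/(k₁!k₂!k₃!)`; the
count itself is not formalised here). [cite: BenfattoEtAl1978, (2.7) p.147 and (5.25) p.157] -/
theorem ursellOf_moment_comp_equiv {Y : ι → Ω → ℝ} (f : σ → ι) (e : σ ≃ σ) :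
    ursellOf (fun P : Finset σ => ∫ ω, ∏ j ∈ P, Y (f (e j)) ω ∂μ) univ =
      ursellOf (fun P : Finset σ => ∫ ω, ∏ j ∈ P, Y (f j) ω ∂μ) univ := by
  have h := ursellOf_map e.toEmbedding (fun P : Finset σ => ∫ ω, ∏ j ∈ P, Y (f j) ω ∂μ) univ
  rw [Finset.map_univ_equiv] at h
  rw [← h]
  congr 1
  funext P
  refine integral_congr_ae (ae_of_all _ fun ω => ?_)
  dsimp only
  rw [Finset.prod_map]
  rfl

end Moments

/-! ## §3  (5.25): the truncated expectations of a SUM, expanded over colourings («Leibnitz formula») -/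

section Leibnitz

variable {Ω : Type*} {mΩ : MeasurableSpace Ω} {μ : Measure Ω} [IsProbabilityMeasure μ]
variable {σ ι : Type*} [Fintype σ] [DecidableEq σ] [Fintype ι] [DecidableEq ι]

omit [IsProbabilityMeasure μ] [DecidableEq ι] in
/-- A sum of finitely many a.e. bounded variables is a.e. bounded by the number of terms times the bound. [folklore] -/
private theorem ae_abs_sum_le {Y : ι → Ω → ℝ} {K : ℝ} (hYK : ∀ c, ∀ᵐ ω ∂μ, |Y c ω| ≤ K) :
    ∀ᵐ ω ∂μ, |∑ c, Y c ω| ≤ Fintype.card ι * K := by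
  have hall : ∀ᵐ ω ∂μ, ∀ c, |Y c ω| ≤ K := ae_all_iff.2 hYK
  refine hall.mono fun ω hω => (Finset.abs_sum_le_sum_abs _ _).trans ?_
  calc ∑ c, |Y c ω| ≤ ∑ _c : ι, K := Finset.sum_le_sum fun c _ => hω c
    _ = Fintype.card ι * K := by rw [Finset.sum_const, nsmul_eq_mul, Finset.card_univ]

omit [DecidableEq ι] in
/-- **MULTILINEARITY OF THE JOINT TRUNCATED EXPECTATIONS** («the elementary summation properties of the truncated functions
following from their definitions», p. 157; (2.7) is multilinear in `x₁, …, x_s`): if the variable in every slot `j` is a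
finite sum `Σ_c W_{c,j}` of a.e. bounded variables, the joint truncated expectation of the slots is the sum over all
colourings `f : σ → ι` of the joint truncated expectations of `(W_{f(j),j})_j`.  Engine: the simultaneous multilinearity
`LatticeModels.ursellOf_piFinset` (on the vertex family `{some j}` of `Option σ`), transported back to the slots by
`LatticeModels.ursellOf_map`. [cite: BenfattoEtAl1978, (2.7) p.147 and (5.25) p.157] -/
theorem ursellOf_moment_sum_eq_sum [Nonempty σ] [Nonempty ι] {W : ι → σ → Ω → ℝ} {K : ℝ}
    (hWm : ∀ c j, AEStronglyMeasurable (W c j) μ) (hWK : ∀ c j, ∀ᵐ ω ∂μ, |W c j ω| ≤ K) :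
    ursellOf (fun P : Finset σ => ∫ ω, ∏ j ∈ P, (∑ c, W c j ω) ∂μ) univ =
      ∑ f : σ → ι, ursellOf (fun P : Finset σ => ∫ ω, ∏ j ∈ P, W (f j) j ω ∂μ) univ := by
  -- the vertex family `V = {some j}` of `Option σ` and the two moment functions on it
  set V : Finset (Option σ) := (univ : Finset σ).map Function.Embedding.some with hV
  have hVne : V.Nonempty := by
    obtain ⟨j⟩ := ‹Nonempty σ›
    exact ⟨some j, Finset.mem_map.2 ⟨j, mem_univ _, rfl⟩⟩
  have hsomeV : ∀ j : σ, some j ∈ V := fun j => Finset.mem_map.2 ⟨j, mem_univ _, rfl⟩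
  set m : Finset (Option σ) → ℝ :=
    fun P => ∫ ω, ∏ j : σ, (if some j ∈ P then ∑ c, W c j ω else 1) ∂μ with hm
  set mz : (σ → ι) → Finset (Option σ) → ℝ :=
    fun z P => ∫ ω, ∏ j : σ, (if some j ∈ P then W (z j) j ω else 1) ∂μ with hmz
  -- membership in `P.map some`
  have hmem : ∀ (P : Finset σ) (j : σ), (some j ∈ P.map Function.Embedding.some) = (j ∈ P) := fun P j =>
    propext ⟨fun h => by
      obtain ⟨i, hi, hij⟩ := Finset.mem_map.1 h
      rwa [← Option.some_injective _ hij], fun h => Finset.mem_map.2 ⟨j, h, rfl⟩⟩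
  -- Step 1: the left side is `ursellOf m V`
  have h1 : ursellOf (fun P : Finset σ => ∫ ω, ∏ j ∈ P, (∑ c, W c j ω) ∂μ) univ = ursellOf m V := by
    rw [hV, ← ursellOf_map Function.Embedding.some m univ]
    congr 1
    funext P
    simp only [hm]
    refine integral_congr_ae (ae_of_all _ fun ω => ?_)
    dsimp only
    simp_rw [hmem P]
    rw [Finset.prod_ite_mem, Finset.univ_inter]
  -- Step 2: simultaneous multilinearity over the colourings of the slots
  obtain ⟨c₁⟩ := ‹Nonempty ι›
  have hint : ∀ (z : σ → ι) (P : Finset (Option σ)),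
      Integrable (fun ω => ∏ j : σ, (if some j ∈ P then W (z j) j ω else 1)) μ := by
    intro z P
    refine integrable_prod_of_bound (K := fun j => if some j ∈ P then K else 1) univ (fun j _ => ?_) (fun j _ => ?_)
    · by_cases hj : some j ∈ P
      · simp only [hj, if_true]
        exact hWm (z j) j
      · simp only [hj, if_false]
        exact aestronglyMeasurable_const
    · by_cases hj : some j ∈ P
      · simp only [hj, if_true]
        exact hWK (z j) j
      · simp only [hj, if_false, abs_one]
        exact ae_of_all _ fun _ => le_rfl
  have h2 : ursellOf m V =
      ∑ z ∈ Fintype.piFinset (colours (fun _ : σ => (univ : Finset ι)) (fun _ => c₁) V),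
        ursellOf (mz z) V := by
    refine ursellOf_piFinset (fun _ => univ) (fun _ => c₁) m mz ?_ ?_ hVne
    · intro P z z' hzz'
      simp only [hmz]
      refine integral_congr_ae (ae_of_all _ fun ω => ?_)
      refine Finset.prod_congr rfl fun j _ => ?_
      by_cases hj : some j ∈ P
      · rw [if_pos hj, if_pos hj, hzz' j hj]
      · rw [if_neg hj, if_neg hj]
    · intro P
      simp only [hm, hmz]
      rw [← integral_finsetSum _ fun z _ => hint z P]
      refine integral_congr_ae (ae_of_all _ fun ω => ?_)
      have key : ∀ j : σ, (if some j ∈ P then ∑ c, W c j ω else 1) =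
          ∑ c ∈ colours (fun _ : σ => (univ : Finset ι)) (fun _ => c₁) P j,
            (if some j ∈ P then W c j ω else 1) := by
        intro j
        by_cases hj : some j ∈ P
        · rw [if_pos hj, colours, if_pos hj]
          simp only [if_pos hj]
        · rw [if_neg hj, colours, if_neg hj, Finset.sum_singleton, if_neg hj]
      dsimp only
      rw [Finset.prod_congr rfl fun j _ => key j, Finset.prod_univ_sum]
  -- Step 3: on `V` every slot is present, so the colourings are all maps `σ → ι`
  have h3 : Fintype.piFinset (colours (fun _ : σ => (univ : Finset ι)) (fun _ => c₁) V) = univ := by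
    have hc : colours (fun _ : σ => (univ : Finset ι)) (fun _ => c₁) V = fun _ => univ := by
      funext j
      rw [colours, if_pos (hsomeV j)]
    rw [hc, Fintype.piFinset_univ]
  -- Step 4: back from `Option σ` to the slots
  have h4 : ∀ z : σ → ι,
      ursellOf (mz z) V = ursellOf (fun P : Finset σ => ∫ ω, ∏ j ∈ P, W (z j) j ω ∂μ) univ := by
    intro z
    rw [hV, ← ursellOf_map Function.Embedding.some (mz z) univ]
    congr 1
    funext P
    simp only [hmz]
    refine integral_congr_ae (ae_of_all _ fun ω => ?_)
    dsimp only
    simp_rw [hmem P]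
    rw [Finset.prod_ite_mem, Finset.univ_inter]
  rw [h1, h2, h3]
  exact Finset.sum_congr rfl fun z _ => h4 z

omit [Fintype σ] in
/-- **A TRUNCATED EXPECTATION IS A URSELL FUNCTION OF PRODUCT MOMENTS**: `𝓔^T(S; |σ|) = (P ↦ ∫ Π_{j∈P} S dμ)ᵀ(σ)` for an
a.e. bounded `S` under a probability measure — `B1Eq323SetPartitions.ursellOf_nmoment_eq_truncExp` with `∫ S^{|P|} =
∫ Π_{j∈P} S`. [cite: BenfattoEtAl1978, (2.7) p.147] -/
theorem truncExp_eq_ursellOf_moment {S : Ω → ℝ} {B : ℝ} (hSm : AEMeasurable S μ) (hSB : ∀ᵐ ω ∂μ, |S ω| ≤ B)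
    {T : Finset σ} (hT : T.Nonempty) :
    truncExp S μ T.card = ursellOf (fun P : Finset σ => ∫ ω, ∏ _j ∈ P, S ω ∂μ) T := by
  rw [← ursellOf_nmoment_eq_truncExp hSm hSB hT]
  congr 1
  funext P
  rw [nmoment, probReal_univ, div_one]
  refine integral_congr_ae (ae_of_all _ fun ω => ?_)
  dsimp only
  rw [Finset.prod_const]

omit [DecidableEq ι] in
/-- **(5.25) — «we have used the elementary summation properties of the truncated functions following from their
definitions ("Leibnitz formula")»**, in colouring form: for a finite family `Y_c` (`c ∈ ι`) of a.e. bounded variables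
under a probability measure `P̄`, the `k`-th truncated expectation of the SUM is the sum, over all colourings
`f : {1,…,k} → ι` of the `k` slots, of the joint truncated expectations `𝓔^T(Y_{f(1)}, …, Y_{f(k)})`
(`= LatticeModels.ursellOf` of the joint moments `P ↦ ∫ Π_{j∈P} Y_{f(j)} dP̄`):
`𝓔^T(Σ_c Y_c; k) = Σ_{f : σ → ι} 𝓔^T(Y_{f(1)},…,Y_{f(k)})` (`k = |σ| ≥ 1`).  Grouping by the multiplicities of `f`
(`ursellOf_moment_comp_equiv`) gives print's display `𝓔^T((Ψ₁+Ψ₂+Ψ₃)χ; k) = Σ_{k₁+k₂+k₃=k} k!/(k₁!k₂!k₃!)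
𝓔^T(Ψ₁χ,Ψ₂χ,Ψ₃χ;k₁,k₂,k₃)`. [cite: BenfattoEtAl1978, (5.25) p.157] -/
theorem truncExp_sum_eq_sum_ursellOf [Nonempty σ] [Nonempty ι] {Y : ι → Ω → ℝ} {K : ℝ}
    (hYm : ∀ c, AEStronglyMeasurable (Y c) μ) (hYK : ∀ c, ∀ᵐ ω ∂μ, |Y c ω| ≤ K) :
    truncExp (fun ω => ∑ c, Y c ω) μ (Fintype.card σ) =
      ∑ f : σ → ι, ursellOf (fun P : Finset σ => ∫ ω, ∏ j ∈ P, Y (f j) ω ∂μ) univ := by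
  have hSm : AEMeasurable (fun ω => ∑ c, Y c ω) μ := by
    have h : AEStronglyMeasurable (∑ c : ι, Y c) μ := Finset.aestronglyMeasurable_sum univ fun c _ => hYm c
    have hfun : (∑ c : ι, Y c) = fun ω => ∑ c, Y c ω := by
      funext ω
      simp [Finset.sum_apply]
    rw [hfun] at h
    exact h.aemeasurable
  rw [← Finset.card_univ, truncExp_eq_ursellOf_moment hSm (ae_abs_sum_le hYK) Finset.univ_nonempty]
  exact ursellOf_moment_sum_eq_sum (W := fun c _ => Y c) (fun c _ => hYm c) (fun c _ => hYK c)

end Leibnitz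

/-! ## §4  (5.25) + (5.26): dropping an exponentially small summand from a truncated expectation -/

section Dropping

variable {Ω : Type*} {mΩ : MeasurableSpace Ω} {μ : Measure Ω} [IsProbabilityMeasure μ]
variable {σ ι : Type*} [Fintype σ] [DecidableEq σ] [Fintype ι] [DecidableEq ι]

/-- The colourings avoiding a colour `c₀` are the colourings by the remaining colours. [folklore] -/
private theorem sum_filter_forall_ne_eq {M : Type*} [AddCommMonoid M] (c₀ : ι) (g : (σ → ι) → M) :
    ∑ f ∈ univ.filter (fun f : σ → ι => ∀ j, f j ≠ c₀), g f =
      ∑ f' : σ → {c // c ≠ c₀}, g (fun j => (f' j).1) := by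
  rw [Finset.sum_subtype (univ.filter (fun f : σ → ι => ∀ j, f j ≠ c₀)) (p := fun f : σ → ι => ∀ j, f j ≠ c₀)
    (fun f => by simp)]
  exact Fintype.sum_equiv (Equiv.subtypePiEquivPi (α := σ) (β := fun _ => ι) (p := fun _ c => c ≠ c₀))
    (fun f : {f : σ → ι // ∀ j, f j ≠ c₀} => g f.1) (fun f' => g fun j => (f' j).1) fun _ => rfl

/-- **(5.25) + (5.26) COMBINED — dropping an exponentially small summand**: for a finite family `Y_c` with
`|Y_c| ≤ K` a.e. and one member `|Y_{c₀}| ≤ ε ≤ K` (print: `Y_{c₀} = Ψ₃χ = H′^{(l)}χ_b^□`,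
`ε = s₁Ab^{D+2d}e^{−ϰb^{3/2}/8}` by (5.24); the others `Ψ₁χ, Ψ₂χ` with `K = s₂Ab^{D+2d}`), the `k`-th truncated
expectation of the full sum and of the sum WITHOUT `Y_{c₀}` differ by at most
`|ι|^k·(Σ_{π ∈ 𝒫(k)} (|π| − 1)!)·ε·K^{k−1}` — (5.25) expands both over colourings (`truncExp_sum_eq_sum_ursellOf`), the
difference is the sum over the colourings USING `c₀` («the third term» of (5.25), `k₃ > 0`), each bounded by
`abs_ursellOf_moment_le_of_hits`, and there are at most `|ι|^k` of them: print's
`|Σ_{k₃>0} 𝓔^T_{z_{Γ₁}}(Ψ₁χ,Ψ₂χ,Ψ₃χ;k₁,k₂,k₃) k!/(k₁!k₂!k₃!)| ≦ s₃(s₁Ab^{D+2d})^k e^{−(ϰ/8)b^{3/2}}` (5.26).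
[cite: BenfattoEtAl1978, (5.25)–(5.26) p.157] -/
theorem abs_truncExp_sum_sub_truncExp_sum_ne_le [Nonempty σ] {Y : ι → Ω → ℝ} {K ε : ℝ} {c₀ c₁ : ι}
    (hc₁ : c₁ ≠ c₀) (hYm : ∀ c, AEStronglyMeasurable (Y c) μ) (hK : ∀ c, ∀ᵐ ω ∂μ, |Y c ω| ≤ K)
    (hε : ∀ᵐ ω ∂μ, |Y c₀ ω| ≤ ε) (hε0 : 0 ≤ ε) (hεK : ε ≤ K) :
    |truncExp (fun ω => ∑ c, Y c ω) μ (Fintype.card σ) -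
        truncExp (fun ω => ∑ c : {c // c ≠ c₀}, Y c.1 ω) μ (Fintype.card σ)| ≤
      (Fintype.card ι : ℝ) ^ Fintype.card σ *
        ((∑ π ∈ setPartitions (univ : Finset σ), ((π.card - 1)! : ℝ)) * (ε * K ^ (Fintype.card σ - 1))) := by
  haveI : Nonempty ι := ⟨c₀⟩
  haveI : Nonempty {c // c ≠ c₀} := ⟨⟨c₁, hc₁⟩⟩
  set g : (σ → ι) → ℝ := fun f => ursellOf (fun P : Finset σ => ∫ ω, ∏ j ∈ P, Y (f j) ω ∂μ) univ with hg
  have h1 : truncExp (fun ω => ∑ c, Y c ω) μ (Fintype.card σ) = ∑ f : σ → ι, g f :=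
    truncExp_sum_eq_sum_ursellOf (σ := σ) (μ := μ) hYm hK
  have h2 : truncExp (fun ω => ∑ c : {c // c ≠ c₀}, Y c.1 ω) μ (Fintype.card σ) =
      ∑ f' : σ → {c // c ≠ c₀}, g (fun j => (f' j).1) :=
    truncExp_sum_eq_sum_ursellOf (σ := σ) (μ := μ) (Y := fun c : {c // c ≠ c₀} => Y c.1)
      (fun c => hYm c.1) (fun c => hK c.1)
  rw [h1, h2, ← sum_filter_forall_ne_eq c₀ g,
    ← Finset.sum_filter_add_sum_filter_not univ (fun f : σ → ι => ∀ j, f j ≠ c₀) g, add_sub_cancel_left]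
  have hterm : ∀ f ∈ univ.filter (fun f : σ → ι => ¬∀ j, f j ≠ c₀),
      |g f| ≤ (∑ π ∈ setPartitions (univ : Finset σ), ((π.card - 1)! : ℝ)) * (ε * K ^ (Fintype.card σ - 1)) := by
    intro f hf
    obtain ⟨j₀, hj₀⟩ : ∃ j, f j = c₀ := by
      simpa using (Finset.mem_filter.1 hf).2
    exact abs_ursellOf_moment_le_of_hits hK hε hε0 hεK f hj₀
  refine (Finset.abs_sum_le_sum_abs _ _).trans ((Finset.sum_le_sum hterm).trans ?_)
  rw [Finset.sum_const, nsmul_eq_mul]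
  have hB : 0 ≤ (∑ π ∈ setPartitions (univ : Finset σ), ((π.card - 1)! : ℝ)) * (ε * K ^ (Fintype.card σ - 1)) :=
    mul_nonneg (apriori_nonneg _) (mul_nonneg hε0 (pow_nonneg (hε0.trans hεK) _))
  refine mul_le_mul_of_nonneg_right ?_ hB
  calc ((univ.filter (fun f : σ → ι => ¬∀ j, f j ≠ c₀)).card : ℝ) ≤ ((univ : Finset (σ → ι)).card : ℝ) := by
        exact_mod_cast Finset.card_filter_le _ _
    _ = (Fintype.card ι : ℝ) ^ Fintype.card σ := by
        rw [Finset.card_univ, Fintype.card_fun]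
        push_cast
        rfl

/-- **(5.26) FOR PRINT'S THREE PIECES** `Ψ₁χ, Ψ₂χ, Ψ₃χ` of (5.23): with `|Ψ₁χ|, |Ψ₂χ| ≤ K` and `|Ψ₃χ| ≤ ε ≤ K` a.e. under
`P̄(dz_□|z_{Γ₁})`, `|𝓔^T((Ψ₁+Ψ₂+Ψ₃)χ; k) − 𝓔^T((Ψ₁+Ψ₂)χ; k)| ≤ 3^k·(Σ_{π ∈ 𝒫(k)} (|π| − 1)!)·ε·K^{k−1}`: the first two
terms of (5.25) are `𝓔^T((Ψ₁+Ψ₂)χ; k)` (the colourings by `{1, 2}`), the third is bounded by (5.26).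
[cite: BenfattoEtAl1978, (5.25)–(5.26) p.157] -/
theorem eq526_three [Nonempty σ] {X₁ X₂ X₃ : Ω → ℝ} {K ε : ℝ}
    (h₁m : AEStronglyMeasurable X₁ μ) (h₂m : AEStronglyMeasurable X₂ μ) (h₃m : AEStronglyMeasurable X₃ μ)
    (h₁K : ∀ᵐ ω ∂μ, |X₁ ω| ≤ K) (h₂K : ∀ᵐ ω ∂μ, |X₂ ω| ≤ K) (h₃ε : ∀ᵐ ω ∂μ, |X₃ ω| ≤ ε)
    (hε0 : 0 ≤ ε) (hεK : ε ≤ K) :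
    |truncExp (fun ω => X₁ ω + X₂ ω + X₃ ω) μ (Fintype.card σ) -
        truncExp (fun ω => X₁ ω + X₂ ω) μ (Fintype.card σ)| ≤
      3 ^ Fintype.card σ *
        ((∑ π ∈ setPartitions (univ : Finset σ), ((π.card - 1)! : ℝ)) * (ε * K ^ (Fintype.card σ - 1))) := by
  set Y : Fin 3 → Ω → ℝ := ![X₁, X₂, X₃] with hY
  have hYm : ∀ c, AEStronglyMeasurable (Y c) μ := fun c => by
    fin_cases c
    · simpa [hY] using h₁m
    · simpa [hY] using h₂m
    · simpa [hY] using h₃m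
  have hYK : ∀ c, ∀ᵐ ω ∂μ, |Y c ω| ≤ K := fun c => by
    fin_cases c
    · simpa [hY] using h₁K
    · simpa [hY] using h₂K
    · simpa [hY] using h₃ε.mono fun ω hω => hω.trans hεK
  have hε : ∀ᵐ ω ∂μ, |Y 2 ω| ≤ ε := by simpa [hY] using h₃ε
  have h := abs_truncExp_sum_sub_truncExp_sum_ne_le (σ := σ) (c₀ := (2 : Fin 3)) (c₁ := 0) (by decide)
    hYm hYK hε hε0 hεK
  have hsum3 : (fun ω => ∑ c, Y c ω) = fun ω => X₁ ω + X₂ ω + X₃ ω := by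
    funext ω
    simp [hY, Fin.sum_univ_three]
  have hsum2 : (fun ω => ∑ c : {c : Fin 3 // c ≠ 2}, Y c.1 ω) = fun ω => X₁ ω + X₂ ω := by
    funext ω
    rw [← Finset.sum_subtype (univ.filter fun c : Fin 3 => c ≠ 2) (p := fun c : Fin 3 => c ≠ 2) (fun c => by simp)
      (fun c => Y c ω)]
    have hset : (univ.filter fun c : Fin 3 => c ≠ 2) = {0, 1} := by decide
    rw [hset, Finset.sum_pair (by decide)]
    simp [hY]
  rw [hsum3, hsum2] at h
  simpa using h

end Dropping

/-! ## §5  (5.29), first term: «the replacement of the χ's by 1» in a joint truncated expectation — generic form -/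

section ChiToOne

variable {Ω : Type*} {mΩ : MeasurableSpace Ω} {μ : Measure Ω} [IsProbabilityMeasure μ]
variable {σ : Type*} [Fintype σ] [DecidableEq σ]

omit [Fintype σ] [DecidableEq σ] in
/-- A joint moment containing at least one factor `Z_j(1 − χ)` lives on `{χ ≠ 1}`: if `|Z_j| ≤ K` a.e., `0 ≤ χ ≤ 1` and
the colouring `f` marks the slots carrying `−Z_j(1−χ)` (`true`) resp. `Z_j` (`false`), then for every `P` containing a
marked slot `|∫ Π_{j∈P} W_{f(j),j}| ≤ K^{|P|}·P̄(χ ≠ 1)`. [folklore] -/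
private theorem abs_integral_prod_mark_le {Z : σ → Ω → ℝ} {χ : Ω → ℝ} {K : ℝ}
    (hZK : ∀ j, ∀ᵐ ω ∂μ, |Z j ω| ≤ K) (hχm : Measurable χ) (hχ0 : ∀ ω, 0 ≤ χ ω) (hχ1 : ∀ ω, χ ω ≤ 1)
    (f : σ → Bool) (P : Finset σ) {j₀ : σ} (hj₀ : j₀ ∈ P) (hf : f j₀ = true) :
    |∫ ω, ∏ j ∈ P, (if f j then -(Z j ω * (1 - χ ω)) else Z j ω) ∂μ| ≤
      K ^ P.card * μ.real {ω | χ ω ≠ 1} := by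
  have hK0 : 0 ≤ K := by
    obtain ⟨ω, hω⟩ := (hZK j₀).exists
    exact (abs_nonneg _).trans hω
  have hS : MeasurableSet {ω | χ ω ≠ 1} := (measurableSet_eq_fun hχm measurable_const).compl
  have hae : ∀ᵐ ω ∂μ, ∀ j ∈ P, |Z j ω| ≤ K := (Filter.eventually_all_finset P).2 fun j _ => hZK j
  calc |∫ ω, ∏ j ∈ P, (if f j then -(Z j ω * (1 - χ ω)) else Z j ω) ∂μ|
      ≤ ∫ ω, |∏ j ∈ P, (if f j then -(Z j ω * (1 - χ ω)) else Z j ω)| ∂μ := abs_integral_le_integral_abs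
    _ ≤ ∫ ω, {ω | χ ω ≠ 1}.indicator (fun _ => K ^ P.card) ω ∂μ := by
        refine integral_mono_of_nonneg (ae_of_all _ fun ω => abs_nonneg _)
          ((integrable_const _).indicator hS) (hae.mono fun ω hω => ?_)
        dsimp only
        by_cases hχ : χ ω = 1
        · -- the marked factor vanishes
          have hzero : (if f j₀ then -(Z j₀ ω * (1 - χ ω)) else Z j₀ ω) = 0 := by
            rw [if_pos hf, hχ, sub_self, mul_zero, neg_zero]
          rw [Finset.prod_eq_zero hj₀ hzero, abs_zero, Set.indicator_of_notMem (by simpa using hχ)]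
        · rw [Set.indicator_of_mem (by simpa using hχ), Finset.abs_prod, ← Finset.prod_const]
          refine Finset.prod_le_prod (fun j _ => abs_nonneg _) fun j hj => ?_
          by_cases hfj : f j = true
          · rw [if_pos hfj, abs_neg, abs_mul]
            have h1 : |1 - χ ω| ≤ 1 := by
              rw [abs_of_nonneg (sub_nonneg.2 (hχ1 ω))]
              linarith [hχ0 ω]
            exact (mul_le_mul (hω j hj) h1 (abs_nonneg _) hK0).trans_eq (mul_one K)
          · rw [if_neg hfj]
            exact hω j hj
    _ = K ^ P.card * μ.real {ω | χ ω ≠ 1} := by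
        rw [integral_indicator_const _ hS, smul_eq_mul, mul_comm]

/-- **(5.29), FIRST TERM — «the replacement of the χ's by 1», GENERIC FORM**: for slots `Z_j` with `|Z_j| ≤ K` a.e., a
weight `0 ≤ χ ≤ 1` and `P̄(χ ≠ 1) ≤ η^k` (`0 ≤ η ≤ 1`, `k = |σ|`), the joint truncated expectations of `(Z_jχ)_j` and of
`(Z_j)_j` differ by at most `2^k·(Σ_{π∈𝒫(k)}(|π|−1)!)·η·K^k`: expand `Z_jχ = Z_j − Z_j(1−χ)` multilinearly
(`ursellOf_moment_sum_eq_sum`, colours `Bool`); every colouring with a marked slot has all its moments through marked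
slots supported on `{χ ≠ 1}` (`abs_integral_prod_mark_le`), so the a-priori bound `abs_ursellOf_le` applies with the
weight `ηK` on marked slots.  AS PROVED this is WEAKER than print's first term of (5.29), `s₄(s₂b^{D+2d}A)^k e^{−b²/4}`
(there `η^k`, not `η`, multiplies: print uses the Gaussian structure — Appendix D «point 2) and Lemma 1 of Appendix C» —
which a measure-theoretic argument cannot see); with (5.19) `P̄(χ_b^□ ≠ 1) ≤ 3b^{2d}e^{−b²/4}` it gives the rate
`e^{−b²/(4k)}`, still dominated by the `e^{−ρ₃b^{3/2}}` of (4.6)–(4.7). [cite: BenfattoEtAl1978, (5.29) p.157–158] -/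
theorem abs_ursellOf_moment_mul_sub_le [Nonempty σ] {Z : σ → Ω → ℝ} {χ : Ω → ℝ} {K η : ℝ}
    (hZm : ∀ j, AEStronglyMeasurable (Z j) μ) (hZK : ∀ j, ∀ᵐ ω ∂μ, |Z j ω| ≤ K)
    (hχm : Measurable χ) (hχ0 : ∀ ω, 0 ≤ χ ω) (hχ1 : ∀ ω, χ ω ≤ 1)
    (hη0 : 0 ≤ η) (hη1 : η ≤ 1) (htail : μ.real {ω | χ ω ≠ 1} ≤ η ^ Fintype.card σ) :
    |ursellOf (fun P : Finset σ => ∫ ω, ∏ j ∈ P, Z j ω * χ ω ∂μ) univ -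
        ursellOf (fun P : Finset σ => ∫ ω, ∏ j ∈ P, Z j ω ∂μ) univ| ≤
      2 ^ Fintype.card σ *
        ((∑ π ∈ setPartitions (univ : Finset σ), ((π.card - 1)! : ℝ)) * (η * K ^ Fintype.card σ)) := by
  obtain ⟨j₁⟩ := ‹Nonempty σ›
  have hK0 : 0 ≤ K := by
    obtain ⟨ω, hω⟩ := (hZK j₁).exists
    exact (abs_nonneg _).trans hω
  -- the two-colour family: `false ↦ Z_j`, `true ↦ −Z_j(1−χ)`; its sum is `Z_jχ`
  set W : Bool → σ → Ω → ℝ := fun b j ω => if b then -(Z j ω * (1 - χ ω)) else Z j ω with hW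
  have hWm : ∀ b j, AEStronglyMeasurable (W b j) μ := by
    intro b j
    cases b
    · simpa [hW] using hZm j
    · simp only [hW, if_true]
      exact ((hZm j).mul (aestronglyMeasurable_const.sub hχm.aestronglyMeasurable)).neg
  have hWK : ∀ b j, ∀ᵐ ω ∂μ, |W b j ω| ≤ K := by
    intro b j
    cases b
    · simpa [hW] using hZK j
    · refine (hZK j).mono fun ω hω => ?_
      simp only [hW, if_true, abs_neg, abs_mul]
      have h1 : |1 - χ ω| ≤ 1 := by
        rw [abs_of_nonneg (sub_nonneg.2 (hχ1 ω))]
        linarith [hχ0 ω]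
      exact (mul_le_mul hω h1 (abs_nonneg _) hK0).trans_eq (mul_one K)
  have hsum : (fun P : Finset σ => ∫ ω, ∏ j ∈ P, Z j ω * χ ω ∂μ) =
      fun P : Finset σ => ∫ ω, ∏ j ∈ P, (∑ b, W b j ω) ∂μ := by
    funext P
    refine integral_congr_ae (ae_of_all _ fun ω => Finset.prod_congr rfl fun j _ => ?_)
    simp only [hW, Fintype.sum_bool, if_true]
    simp only [Bool.false_eq_true, if_false]
    ring
  rw [hsum, ursellOf_moment_sum_eq_sum (W := W) hWm hWK]
  -- split off the unmarked colouring `f₀ ≡ false`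
  set f₀ : σ → Bool := fun _ => false with hf₀
  have hf₀term : ursellOf (fun P : Finset σ => ∫ ω, ∏ j ∈ P, W (f₀ j) j ω ∂μ) univ =
      ursellOf (fun P : Finset σ => ∫ ω, ∏ j ∈ P, Z j ω ∂μ) univ := by
    simp only [hf₀, hW, Bool.false_eq_true, if_false]
  rw [← Finset.add_sum_erase univ _ (mem_univ f₀), hf₀term, add_sub_cancel_left]
  -- bound the marked colourings
  have hterm : ∀ f ∈ univ.erase f₀,
      |ursellOf (fun P : Finset σ => ∫ ω, ∏ j ∈ P, W (f j) j ω ∂μ) univ| ≤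
        (∑ π ∈ setPartitions (univ : Finset σ), ((π.card - 1)! : ℝ)) * (η * K ^ Fintype.card σ) := by
    intro f hf
    obtain ⟨j₀, hj₀⟩ : ∃ j, f j = true := by
      by_contra hno
      refine (Finset.mem_erase.1 hf).1 (funext fun j => ?_)
      simpa [hf₀] using fun h => hno ⟨j, h⟩
    set Kf : σ → ℝ := fun j => if f j = true then η * K else K with hKf
    have hmom : ∀ P : Finset σ, P ⊆ univ →
        |∫ ω, ∏ j ∈ P, W (f j) j ω ∂μ| ≤ ∏ j ∈ P, Kf j := by
      intro P _
      simp only [hKf]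
      rw [Finset.prod_ite, Finset.prod_const, Finset.prod_const]
      set a := (P.filter fun j => f j = true).card with ha_def
      set c := (P.filter fun j => ¬f j = true).card with hc_def
      have hac : a + c = P.card := by
        rw [ha_def, hc_def, Finset.card_filter_add_card_filter_not]
      by_cases hP : ∃ j ∈ P, f j = true
      · obtain ⟨j, hjP, hjf⟩ := hP
        have ha1 : 1 ≤ a := Finset.card_pos.2 ⟨j, Finset.mem_filter.2 ⟨hjP, hjf⟩⟩
        have hak : a ≤ Fintype.card σ :=
          (Finset.card_filter_le _ _).trans (Finset.card_le_univ _)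
        have hmk := abs_integral_prod_mark_le (μ := μ) hZK hχm hχ0 hχ1 f P hjP hjf
        calc |∫ ω, ∏ j ∈ P, W (f j) j ω ∂μ| ≤ K ^ P.card * μ.real {ω | χ ω ≠ 1} := by
              simpa [hW] using hmk
          _ ≤ K ^ P.card * η ^ Fintype.card σ :=
              mul_le_mul_of_nonneg_left htail (pow_nonneg hK0 _)
          _ ≤ K ^ P.card * η ^ a :=
              mul_le_mul_of_nonneg_left (pow_le_pow_of_le_one hη0 hη1 hak) (pow_nonneg hK0 _)
          _ = (η * K) ^ a * K ^ c := by rw [mul_pow, ← hac, pow_add]; ring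
      · have ha0 : a = 0 := by
          rw [ha_def, Finset.card_eq_zero, Finset.filter_eq_empty_iff]
          exact fun j hj hfj => hP ⟨j, hj, hfj⟩
        have hcP : c = P.card := by omega
        rw [ha0, pow_zero, one_mul, hcP]
        have hplain : (fun ω => ∏ j ∈ P, W (f j) j ω) = fun ω => ∏ j ∈ P, Z j ω := by
          funext ω
          refine Finset.prod_congr rfl fun j hj => ?_
          have hfj : ¬f j = true := fun h => hP ⟨j, hj, h⟩
          simp only [hW, if_neg hfj]
        rw [hplain]
        simpa using abs_integral_prod_le (μ := μ) (K := fun _ => K) P fun j _ => hZK j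
    have hu := abs_ursellOf_le (fun P : Finset σ => ∫ ω, ∏ j ∈ P, W (f j) j ω ∂μ) (by simp)
      Finset.univ_nonempty Kf hmom
    refine hu.trans (mul_le_mul_of_nonneg_left ?_ (apriori_nonneg _))
    -- `Π_j Kf j = (ηK)^a K^(k-a) = η^a K^k ≤ η K^k`
    simp only [hKf]
    rw [Finset.prod_ite, Finset.prod_const, Finset.prod_const]
    set a := (univ.filter fun j => f j = true).card with ha_def
    set c := (univ.filter fun j => ¬f j = true).card with hc_def
    have hac : a + c = Fintype.card σ := by
      rw [ha_def, hc_def, Finset.card_filter_add_card_filter_not]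
      rfl
    have ha1 : 1 ≤ a := Finset.card_pos.2 ⟨j₀, by simp [hj₀]⟩
    calc (η * K) ^ a * K ^ c = η ^ a * K ^ Fintype.card σ := by rw [mul_pow, ← hac, pow_add]; ring
      _ ≤ η ^ 1 * K ^ Fintype.card σ :=
          mul_le_mul_of_nonneg_right (pow_le_pow_of_le_one hη0 hη1 ha1) (pow_nonneg hK0 _)
      _ = η * K ^ Fintype.card σ := by rw [pow_one]
  refine (Finset.abs_sum_le_sum_abs _ _).trans ((Finset.sum_le_sum hterm).trans ?_)
  rw [Finset.sum_const, nsmul_eq_mul]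
  refine mul_le_mul_of_nonneg_right ?_
    (mul_nonneg (apriori_nonneg _) (mul_nonneg hη0 (pow_nonneg hK0 _)))
  calc ((univ.erase f₀).card : ℝ) ≤ ((univ : Finset (σ → Bool)).card : ℝ) := by
        exact_mod_cast Finset.card_erase_le
    _ = 2 ^ Fintype.card σ := by
        rw [Finset.card_univ, Fintype.card_fun, Fintype.card_bool]
        push_cast
        rfl

end ChiToOne

end Literature.MathematicalPhysics.QuantumFieldTheory.Balaban1983to89.B1Eq324BenfattoSect5JointCumulants
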